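import Literature.MathematicalPhysics.QuantumLattice.WilsonBlockHeatBathL2
import Literature.MathematicalPhysics.QuantumLattice.WilsonBlockHeatBathLightCone2
import Literature.Analysis.OperatorTheory.KnabeGapAmplification
import HarnessLib

/-!
# The overlapping block heat-bath sampler — cyclic index geometry of cells and blocks

Elementary combinatorics (theorems only) of the block geometry of `WilsonBlockHeatBath.lean` on the torus of side `N`
with `m` cells per axis and blocks indexed by `Fin 4 → Fin m`, measured with the cyclic index distance `cdist` of
`KnabeGapAmplification.lean` (used by the light cone of the block heat bath, Martinelli 1999 §3):

* the cyclic size `|a| = |valMinAbs a|` on `ZMod m`: bounds, subadditivity, triangle inequality, symmetry;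
* `cellOf_add_one` — one lattice step moves the cell index by `0` or `1` (cyclically), hence neighbouring sites have
  cells differing by `-1, 0, 1`; block sites and their neighbours lie in the `4`-cell WINDOW of the block
  (`window_of_inBlock`, `window_of_inBlock_of_nbr`); a block meeting the window of another is at index distance `≤ 2`
  in every axis (`cdist_le_two_of_window_of_inBlock`); every site lies in a block; `(2r+1)⁴` indices in a cyclic
  window (`card_filter_natAbs_valMinAbs_le`), so the adjacency "`cdist ≤ 2` in every axis" has `≤ 625` columns;
* propagation of bounds along the neighbourhood iteration of the light cone (`2` per step) and its monotonicity;
* `card_blocks_le`, `exists_cellOf_of_inBlock_image`, `natAbs_valMinAbs_index_le`, `min_le_natAbs_valMinAbs_index` —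
  an edge set `T` meets at most `81 |T|` blocks; axis-`0` index bounds of the blocks met by the projected (shifted)
  support of a local observable (with `…LightCone2`).

References: F. Martinelli, *Lectures on Glauber dynamics for discrete spin models*, LNM 1717 (1999), §3.
-/

open scoped BigOperators
open Literature.MathematicalPhysics.QuantumFieldTheory Literature.MathematicalPhysics.QuantumLattice
open Literature.Probability.LatticeModels (Torus.proj Torus.proj_apply)
open Literature.Analysis.OperatorTheory.KnabeDevice (cdist)

noncomputable section

namespace Literature.MathematicalPhysics.QuantumLattice.WilsonBlockHeatBath

/-! ## Part C: cyclic index geometry of cells and blocks -/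
section Geometry


/-! ### The cyclic size `|a|` of `a : ZMod m` -/

/-- The cyclic size `|a| = |valMinAbs a|` of `a : ZMod m` is at most the standard representative. [folklore] -/
theorem natAbs_valMinAbs_le_val {m : ℕ} [NeZero m] (a : ZMod m) : a.valMinAbs.natAbs ≤ a.val := by
  rw [ZMod.valMinAbs_natAbs_eq_min]; exact min_le_left _ _

/-- The cyclic size is at most the distance of the standard representative to `m`. [folklore] -/
theorem natAbs_valMinAbs_le_sub_val {m : ℕ} [NeZero m] (a : ZMod m) :
    a.valMinAbs.natAbs ≤ m - a.val := by
  rw [ZMod.valMinAbs_natAbs_eq_min]; exact min_le_right _ _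

/-- Triangle inequality for the cyclic distance `|a − b|`. [folklore] -/
theorem natAbs_valMinAbs_le_add_sub {m : ℕ} [NeZero m] (a b : ZMod m) :
    b.valMinAbs.natAbs ≤ a.valMinAbs.natAbs + (a - b).valMinAbs.natAbs := by
  have h := (ZMod.natAbs_valMinAbs_add_le a (-(a - b))).trans (Int.natAbs_add_le _ _)
  rw [ZMod.natAbs_valMinAbs_neg] at h
  have : a + -(a - b) = b := by ring
  rwa [this] at h

/-! ### Cells -/

/-- One lattice step changes the cell index by `0` or `1`. [folklore] -/
theorem cellOf_add_one_sub_cellOf {N m : ℕ} [NeZero N] (hm : 0 < m) (hmN : m ≤ N) (x : ZMod N) :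
    cellOf N m (x + 1) - cellOf N m x = 0 ∨ cellOf N m (x + 1) - cellOf N m x = 1 := by
  have hN : 0 < N := Nat.pos_of_ne_zero (NeZero.ne N)
  unfold cellOf
  by_cases hlt : x.val + 1 < N
  · have hval : (x + 1).val = x.val + 1 := by
      haveI : Fact (1 < N) := ⟨by omega⟩
      rw [ZMod.val_add_of_lt (by rwa [ZMod.val_one]), ZMod.val_one]
    rw [hval]
    have hle : x.val * m / N ≤ (x.val + 1) * m / N := Nat.div_le_div_right (by nlinarith)
    have hle' : (x.val + 1) * m / N ≤ x.val * m / N + 1 := by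
      calc (x.val + 1) * m / N ≤ (x.val * m + N) / N := Nat.div_le_div_right (by nlinarith)
        _ = x.val * m / N + 1 := Nat.add_div_right _ hN
    rcases Nat.eq_or_lt_of_le hle with h | h
    · left; rw [← h, sub_self]
    · right
      have : (x.val + 1) * m / N = x.val * m / N + 1 := by omega
      rw [this]; push_cast; ring
  · have hxv : x.val = N - 1 := by have := x.val_lt; omega
    have hx1 : x + 1 = 0 := by
      have : x = -1 := by
        rw [← ZMod.natCast_zmod_val x, hxv, Nat.cast_sub (by omega), ZMod.natCast_self, zero_sub,
          Nat.cast_one]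
      rw [this]; ring
    rw [hx1, ZMod.val_zero, zero_mul, Nat.zero_div, Nat.cast_zero, zero_sub, hxv]
    have hq : (N - 1) * m / N = m - 1 := by
      have h1 : (N - 1) * m = N * (m - 1) + (N - m) := by
        zify [hmN, hm, Nat.one_le_of_lt hN]
        ring
      rw [h1, Nat.mul_add_div hN, Nat.div_eq_of_lt (by omega), add_zero]
    rw [hq, Nat.cast_sub hm, Nat.cast_one, ZMod.natCast_self]
    right; ring

/-- Neighbouring coordinates have cell indices differing by `-1, 0, 1`. [folklore] -/
theorem cellOf_sub_cellOf_of_nbr {N m : ℕ} [NeZero N] (hm : 0 < m) (hmN : m ≤ N) {x x' : ZMod N}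
    (h : x' = x ∨ x' = x + 1 ∨ x = x' + 1) :
    ∃ s : ℤ, s.natAbs ≤ 1 ∧ cellOf N m x' - cellOf N m x = (s : ZMod m) := by
  rcases h with rfl | rfl | rfl
  · exact ⟨0, by simp, by simp⟩
  · rcases cellOf_add_one_sub_cellOf hm hmN x with h | h
    · exact ⟨0, by simp, by simpa using h⟩
    · exact ⟨1, by simp, by simpa using h⟩
  · rcases cellOf_add_one_sub_cellOf hm hmN x' with h | h
    · exact ⟨0, by simp, by rw [← neg_sub, h]; simp⟩
    · exact ⟨-1, by simp, by rw [← neg_sub, h]; simp⟩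

/-! ### Blocks, windows, adjacency -/

/-- A block site lies in the window of its block. [folklore] -/
theorem window_of_inBlock {N m : ℕ} (hm : 3 < m) {z : Fin 4 → Fin m} {x : Site 4 N}
    (h : InBlock N m z x) (k : Fin 4) :
    (cellOf N m (x k) - ((z k : ℕ) : ZMod m) + 1).val ≤ 3 := by
  haveI : NeZero m := ⟨by omega⟩
  haveI : Fact (1 < m) := ⟨by omega⟩
  have := h k
  calc (cellOf N m (x k) - ((z k : ℕ) : ZMod m) + 1).val
      ≤ (cellOf N m (x k) - ((z k : ℕ) : ZMod m)).val + (1 : ZMod m).val := ZMod.val_add_le _ _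
    _ ≤ 1 + 1 := by rw [ZMod.val_one]; exact add_le_add this le_rfl
    _ ≤ 3 := by norm_num

/-- A neighbour of a block site lies in the window of the block. [folklore] -/
theorem window_of_inBlock_of_nbr {N m : ℕ} [NeZero N] (hm : 3 < m) (hmN : m ≤ N)
    {z : Fin 4 → Fin m} {x x' : Site 4 N} (h : InBlock N m z x)
    (hn : ∀ k, x' k = x k ∨ x' k = x k + 1 ∨ x k = x' k + 1) (k : Fin 4) :
    (cellOf N m (x' k) - ((z k : ℕ) : ZMod m) + 1).val ≤ 3 := by
  haveI : NeZero m := ⟨by omega⟩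
  obtain ⟨s, hs, hcell⟩ := cellOf_sub_cellOf_of_nbr (by omega) hmN (hn k)
  have hq := h k
  set q := cellOf N m (x k) - ((z k : ℕ) : ZMod m) with hqdef
  have : cellOf N m (x' k) - ((z k : ℕ) : ZMod m) + 1 = ((s + q.val + 1 : ℤ) : ZMod m) := by
    have e1 : cellOf N m (x' k) = cellOf N m (x k) + (s : ZMod m) := by rw [← hcell]; ring
    rw [e1]
    have e2 : (q.val : ZMod m) = q := ZMod.natCast_zmod_val q
    push_cast
    rw [e2, hqdef]; ring
  rw [this]
  have h0 : 0 ≤ s + q.val + 1 := by omega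
  have h3 : s + q.val + 1 ≤ 3 := by omega
  have hlt : s + q.val + 1 < (m : ℤ) := by omega
  have hv : ((((s + q.val + 1 : ℤ) : ZMod m)).val : ℤ) = s + q.val + 1 := by
    rw [ZMod.val_intCast, Int.emod_eq_of_lt h0 hlt]
  omega

/-- Window and block conditions in some axis force index distance `≤ 2`. [folklore] -/
theorem cdist_le_two_of_window_of_inBlock {N m : ℕ} (hm : 4 < m) {z w : Fin 4 → Fin m}
    {x : Site 4 N} (hz : InBlock N m z x)
    (hw : ∀ k, (cellOf N m (x k) - ((w k : ℕ) : ZMod m) + 1).val ≤ 3) (k : Fin 4) :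
    cdist (z k) (w k) ≤ 2 := by
  haveI : NeZero m := ⟨(Nat.zero_lt_of_lt hm).ne'⟩
  set p := cellOf N m (x k) - ((w k : ℕ) : ZMod m) + 1 with hp
  set q := cellOf N m (x k) - ((z k : ℕ) : ZMod m) with hq
  have hpv := hw k
  have hqv := hz k
  have : ((z k : ℕ) : ZMod m) - ((w k : ℕ) : ZMod m) = ((p.val - 1 - q.val : ℤ) : ZMod m) := by
    push_cast
    rw [ZMod.natCast_zmod_val p, ZMod.natCast_zmod_val q, hp, hq]; ring
  unfold cdist
  rw [this]
  refine (natAbs_valMinAbs_intCast_le _).trans ?_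
  rw [← hp, ← hq] at *
  omega

/-- Counting indices in a cyclic window: at most `(2r+1)⁴` multi-indices `z` with all
`|a_k − z_k| ≤ r`. [folklore] -/
theorem card_filter_natAbs_valMinAbs_le {m : ℕ} (r : ℕ) (_hm : 2 * r < m) (a : Fin 4 → ZMod m) :
    (Finset.univ.filter fun z : Fin 4 → Fin m =>
      ∀ k, ((a k - ((z k : ℕ) : ZMod m)).valMinAbs).natAbs ≤ r).card ≤ (2 * r + 1) ^ 4 := by
  classical
  set T : Fin 4 → Finset (Fin m) := fun k =>
    Finset.univ.filter fun i : Fin m => ((a k - ((i : ℕ) : ZMod m)).valMinAbs).natAbs ≤ r with hT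
  have hsub : (Finset.univ.filter fun z : Fin 4 → Fin m =>
      ∀ k, ((a k - ((z k : ℕ) : ZMod m)).valMinAbs).natAbs ≤ r) ⊆ Fintype.piFinset T := by
    intro z hz
    rw [Fintype.mem_piFinset]
    intro k
    exact Finset.mem_filter.2 ⟨Finset.mem_univ _, (Finset.mem_filter.1 hz).2 k⟩
  have hTk : ∀ k, (T k).card ≤ 2 * r + 1 := by
    intro k
    have hinj : Set.InjOn (fun i : Fin m => (a k - ((i : ℕ) : ZMod m)).valMinAbs) ↑(T k) := by
      intro i _ j _ hij
      simp only at hij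
      have h1 : (a k - ((i : ℕ) : ZMod m)) = a k - ((j : ℕ) : ZMod m) := by
        rw [← ZMod.coe_valMinAbs (a k - ((i : ℕ) : ZMod m)), hij, ZMod.coe_valMinAbs]
      have h2 : ((i : ℕ) : ZMod m) = ((j : ℕ) : ZMod m) := by
        have := congrArg (fun t => a k - t) h1; simpa using this
      have h3 := congrArg ZMod.val h2
      rw [ZMod.val_natCast, ZMod.val_natCast, Nat.mod_eq_of_lt i.isLt, Nat.mod_eq_of_lt j.isLt] at h3
      exact Fin.ext h3
    have hmaps : Set.MapsTo (fun i : Fin m => (a k - ((i : ℕ) : ZMod m)).valMinAbs) ↑(T k)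
        ↑(Finset.Icc (-(r : ℤ)) r) := by
      intro i hi
      have hi' := (Finset.mem_filter.1 hi).2
      simp only [Finset.coe_Icc, Set.mem_Icc]
      constructor <;> omega
    have := Finset.card_le_card_of_injOn _ hmaps hinj
    refine this.trans ?_
    rw [Int.card_Icc]
    omega
  calc _ ≤ (Fintype.piFinset T).card := Finset.card_le_card hsub
    _ = ∏ k, (T k).card := Fintype.card_piFinset T
    _ ≤ ∏ _k : Fin 4, (2 * r + 1) := Finset.prod_le_prod' fun k _ => hTk k
    _ = (2 * r + 1) ^ 4 := by simp



/-- The column count of the index adjacency `∀ k, cdist (z k) (w k) ≤ 2` is at most `5⁴ = 625`. [folklore] -/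
theorem card_filter_cdist_le_two {m : ℕ} (hm : 4 < m) (w : Fin 4 → Fin m) :
    (Finset.univ.filter fun z : Fin 4 → Fin m => ∀ k, cdist (z k) (w k) ≤ 2).card ≤ 625 := by
  have h := card_filter_natAbs_valMinAbs_le 2 (by omega) (fun k => ((w k : ℕ) : ZMod m))
  refine le_trans (le_of_eq (congrArg Finset.card (Finset.filter_congr fun z _ => ?_))) h
  simp only [cdist]
  exact forall_congr' fun k => by rw [natAbs_valMinAbs_sub_comm]

/-! ### Light-cone bookkeeping on the index torus -/

/-- Upper bounds propagate along the neighbourhood iteration, `2` per step. [folklore] -/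
theorem iterate_nbhd_le {ι : Type*} [Fintype ι] (adj : ι → ι → Prop) [DecidableRel adj] (φ : ι → ℕ)
    (hadj : ∀ z w, adj z w → φ z ≤ φ w + 2) (D : ℕ) :
    ∀ (R : Finset ι) (a : ℕ), (∀ w ∈ R, φ w ≤ a) →
      ∀ z ∈ (fun R : Finset ι => Finset.univ.filter fun z => ∃ w ∈ R, adj z w)^[D] R, φ z ≤ a + 2 * D := by
  induction D with
  | zero => intro R a hR z hz; simpa using hR z hz
  | succ D ih =>
    intro R a hR z hz
    rw [Function.iterate_succ_apply] at hz
    have h := ih _ (a + 2) (fun w hw => ?_) z hz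
    · omega
    · obtain ⟨w', hw', hadj'⟩ := (Finset.mem_filter.1 hw).2
      exact (hadj w w' hadj').trans (by have := hR w' hw'; omega)

/-- Lower bounds propagate along the neighbourhood iteration, `2` per step. [folklore] -/
theorem iterate_nbhd_ge {ι : Type*} [Fintype ι] (adj : ι → ι → Prop) [DecidableRel adj] (φ : ι → ℕ)
    (hadj : ∀ z w, adj z w → φ w ≤ φ z + 2) (D : ℕ) :
    ∀ (R : Finset ι) (a : ℕ), (∀ w ∈ R, a ≤ φ w) →
      ∀ z ∈ (fun R : Finset ι => Finset.univ.filter fun z => ∃ w ∈ R, adj z w)^[D] R, a ≤ φ z + 2 * D := by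
  induction D with
  | zero => intro R a hR z hz; simpa using hR z hz
  | succ D ih =>
    intro R a hR z hz
    rw [Function.iterate_succ_apply] at hz
    have h := ih _ (a - 2) (fun w hw => ?_) z hz
    · omega
    · obtain ⟨w', hw', hadj'⟩ := (Finset.mem_filter.1 hw).2
      have := hR w' hw'
      have := hadj w w' hadj'
      omega

/-- A reflexive neighbourhood iteration only grows. [folklore] -/
theorem subset_iterate_nbhd {ι : Type*} [Fintype ι] (adj : ι → ι → Prop) [DecidableRel adj]
    (hrefl : ∀ z, adj z z) (D : ℕ) (R : Finset ι) :
    R ⊆ (fun R : Finset ι => Finset.univ.filter fun z => ∃ w ∈ R, adj z w)^[D] R := by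
  induction D with
  | zero => simp
  | succ D ih =>
    rw [Function.iterate_succ_apply']
    intro z hz
    exact Finset.mem_filter.2 ⟨Finset.mem_univ _, z, ih hz, hrefl z⟩

end Geometry

/-! ## Part H: supports of the lifted observables on the index torus -/
section Supports

variable {G : Type} [Group G] [MeasurableSpace G] {N : ℕ}

omit [Group G] [MeasurableSpace G] in
/-- A site lies in at most `81` overlapping blocks; an edge set `T` meets at most `81 |T|` blocks. [folklore] -/
theorem card_blocks_le {m : ℕ} (hm : 2 < m) (T : Finset (Edge 4 N)) (R : Finset (Fin 4 → Fin m))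
    (hR : ∀ z ∈ R, ∃ e ∈ T, InBlock N m z e.1) : R.card ≤ 81 * T.card := by
  classical
  haveI : NeZero m := ⟨by omega⟩
  have hsub : R ⊆ T.biUnion fun e => Finset.univ.filter fun z : Fin 4 → Fin m =>
      ∀ k, ((cellOf N m (e.1 k) - ((z k : ℕ) : ZMod m)).valMinAbs).natAbs ≤ 1 := by
    intro z hz
    obtain ⟨e, he, hzb⟩ := hR z hz
    exact Finset.mem_biUnion.2 ⟨e, he, Finset.mem_filter.2 ⟨Finset.mem_univ _, fun k =>
      (natAbs_valMinAbs_le_val _).trans (hzb k)⟩⟩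
  refine (Finset.card_le_card hsub).trans (Finset.card_biUnion_le.trans ?_)
  calc ∑ e ∈ T, (Finset.univ.filter fun z : Fin 4 → Fin m =>
        ∀ k, ((cellOf N m (e.1 k) - ((z k : ℕ) : ZMod m)).valMinAbs).natAbs ≤ 1).card
      ≤ ∑ _e ∈ T, 81 := Finset.sum_le_sum fun e _ =>
        (card_filter_natAbs_valMinAbs_le 1 (by omega) (fun k => cellOf N m (e.1 k))).trans (by norm_num)
    _ = 81 * T.card := by rw [Finset.sum_const, smul_eq_mul, mul_comm]

omit [Group G] [MeasurableSpace G] in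
/-- Axis-`0` reading of "block `z` meets the projected shifted support". [folklore] -/
theorem exists_cellOf_of_inBlock_image {m : ℕ} (O : Finset (Literature.MathematicalPhysics.QuantumLattice.ZdEdge 4)) (v : ℕ) {z : Fin 4 → Fin m}
    (hz : ∃ e ∈ O.image (fun e : Literature.MathematicalPhysics.QuantumLattice.ZdEdge 4 => torusEdge N (e.1 + Pi.single 0 (v : ℤ), e.2)),
      InBlock N m z e.1) :
    ∃ e₀ ∈ O, (cellOf N m (((e₀.1 0 + v : ℤ)) : ZMod N) - ((z 0 : ℕ) : ZMod m)).val ≤ 1 := by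
  obtain ⟨e, he, hzb⟩ := hz
  obtain ⟨e₀, he₀, rfl⟩ := Finset.mem_image.1 he
  refine ⟨e₀, he₀, ?_⟩
  have := hzb 0
  simpa [torusEdge, Torus.proj_apply] using this

omit [Group G] [MeasurableSpace G] in
/-- Blocks meeting the projected (unshifted) support have axis-`0` index within cyclic distance `M + 2` of `0`. [folklore] -/
theorem natAbs_valMinAbs_index_le {N m M : ℕ} [NeZero N] (hm : 0 < m) (hmN : m ≤ N) (hMN : M < N)
    (O : Finset (Literature.MathematicalPhysics.QuantumLattice.ZdEdge 4)) (hMO : ∀ e ∈ O, (e.1 0).natAbs ≤ M)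
    {z : Fin 4 → Fin m} (hz : ∃ e ∈ O.image (fun e : Literature.MathematicalPhysics.QuantumLattice.ZdEdge 4 =>
      torusEdge N (e.1 + Pi.single 0 ((0 : ℕ) : ℤ), e.2)), InBlock N m z e.1) :
    ((((z 0 : ℕ) : ZMod m)).valMinAbs).natAbs ≤ M + 2 := by
  haveI : NeZero m := ⟨hm.ne'⟩
  obtain ⟨e₀, he₀, hc⟩ := exists_cellOf_of_inBlock_image O 0 hz
  have h1 := natAbs_valMinAbs_cellOf_le (N := N) hm hmN hMN (e₀.1 0) (hMO e₀ he₀)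
  have h2 := natAbs_valMinAbs_le_add_sub (cellOf N m (((e₀.1 0 + (0 : ℕ) : ℤ)) : ZMod N))
    (((z 0 : ℕ) : ZMod m))
  have h3 := natAbs_valMinAbs_le_val (cellOf N m (((e₀.1 0 + (0 : ℕ) : ℤ)) : ZMod N) - ((z 0 : ℕ) : ZMod m))
  simp only [Nat.cast_zero, add_zero] at h2 h3 hc
  omega

omit [Group G] [MeasurableSpace G] in
/-- Blocks meeting the projected support shifted by `n` in time (`M ≤ n ≤ S`, torus side `2S+1`) have axis-`0`
index at cyclic distance `≥ min ((n-M)m/N, m-(n+M)m/N) - 1` from `0`. [folklore] -/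
theorem min_le_natAbs_valMinAbs_index {N m M n S : ℕ} [NeZero N] (hN : N = 2 * S + 1) (hm : 0 < m)
    (hMn : M ≤ n) (hnS : n ≤ S) (O : Finset (Literature.MathematicalPhysics.QuantumLattice.ZdEdge 4))
    (hMO : ∀ e ∈ O, (e.1 0).natAbs ≤ M) {w : Fin 4 → Fin m}
    (hw : ∃ e ∈ O.image (fun e : Literature.MathematicalPhysics.QuantumLattice.ZdEdge 4 =>
      torusEdge N (e.1 + Pi.single 0 ((n : ℕ) : ℤ), e.2)), InBlock N m w e.1) :
    min ((n - M) * m / N) (m - (n + M) * m / N) ≤ ((((w 0 : ℕ) : ZMod m)).valMinAbs).natAbs + 1 := by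
  haveI : NeZero m := ⟨hm.ne'⟩
  obtain ⟨e₀, he₀, hc⟩ := exists_cellOf_of_inBlock_image O n hw
  have h1 := le_natAbs_valMinAbs_cellOf_shift (m := m) hN hm hMn hnS (e₀.1 0) (hMO e₀ he₀)
  have h2 := natAbs_valMinAbs_le_add_sub (((w 0 : ℕ) : ZMod m))
    (cellOf N m (((e₀.1 0 + n : ℤ)) : ZMod N))
  have h3 := natAbs_valMinAbs_le_val (cellOf N m (((e₀.1 0 + n : ℤ)) : ZMod N) - ((w 0 : ℕ) : ZMod m))
  rw [natAbs_valMinAbs_sub_comm] at h2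
  omega

end Supports

end Literature.MathematicalPhysics.QuantumLattice.WilsonBlockHeatBath

end
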